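import Mathlib
import HarnessLib
import Summits.CriticalPhenomena.CardyFormulaZ2.Theses.CardyMagicRigidity
import Summits.CriticalPhenomena.CardyFormulaZ2.Theorems.CardyMagicRigidityMagicFormulaTCoefficientResidue
import Summits.CriticalPhenomena.CardyFormulaZ2.Theorems.CardyMagicRigidityMagicFormulaTSecondOrderReduction
import Literature.Probability.RandomPlanarGeometry.NestingTransform

/-!
# Line `Sketch` for crux `MagicFormulaT`: the two-point power-sum limit is necessary

Crux `Summit.CriticalPhenomena.CardyFormulaZ2.Theses.CardyMagicRigidity.MagicFormulaT`
(stmt-CriticalPhenomena-4836), line `Sketch`, registered stub `twoPoint_of_magicFormulaT`.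

Notation.  For an admissible density `f : ℂ → ℝ` (`f` measurable, `|f| ≤ C`, `f = 0` off
`B̄(0, R)`, `∫ f = 0`) and a loop `u` put `θ_u = u.nestingPhase f`; for the loops of
`siteLoopConfig δ ω` put `A₁ = Σᶠ_u θ_u`, `A₂ = Σᶠ_u θ_u²`, `Φ_δ(t) = E_{1/2}[∏ᶠ_u 2cos(t θ_u + π/3)]`,
and let `G_f(t) = exp(q(f) t²)` with `q(f) = (3/4π²) ∬ log‖x − y‖ f(x) f(y)`.

**Theorem (`twoPoint_of_magicFormulaT`).**  The crux `MagicFormulaT` implies, for every admissible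
`f`, the two-point power-sum limit
`E_{1/2}[3A₁² − 4A₂] → 2 q(f) = (3/2π²) ∬ log‖x − y‖ f(x) f(y)` as `δ → 0⁺`.

Proof.  The crux identifies every Taylor coefficient of `Φ_δ` at `t = 0` with that of `G_f` in the
limit `δ → 0⁺` (`cfi_coefficients_of_magicFormulaT`, unconditional); at order `2` the Gaussian side
is `G_f''(0) = 2 q(f)` (`so_iteratedDeriv_two_cexp_mul_sq`) and, for `δ > 0`, the lattice side is
`Φ_δ''(0) = E_{1/2}[3A₁² − 4A₂]`, a real number (`so_iteratedDeriv_two_eq_ofReal_integral`).  Since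
`ℝ → ℂ` is a closed embedding (`Filter.tendsto_ofReal_iff`), the real expectations converge to
`2 q(f)`.  Pure glue over landed material; no named fact is used; no definition is introduced.
-/

noncomputable section

namespace Summit.CriticalPhenomena.CardyFormulaZ2.Cruxes.MagicFormulaT.LineSketch

open MeasureTheory Filter Set
open scoped Real Topology BigOperators ENNReal
open Literature.Probability.RandomPlanarGeometry Literature.Probability.Percolation
  Literature.Probability.LatticeModels

/-- **Stub `twoPoint_of_magicFormulaT` · the two-point power-sum limit is necessary for the
crux.**  If `MagicFormulaT` holds then, for every admissible density `f` (`f` measurable,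
`|f| ≤ C`, `f = 0` off `B̄(0, R)`, `∫ f = 0`),
`E_{1/2}[3A₁² − 4A₂] → (3/2π²) ∬ log‖x − y‖ f(x) f(y)` as `δ → 0⁺`
(`A_m = Σᶠ_u θ_u(f)^m` over the loops of `siteLoopConfig δ ω`): the order-`2` case of the
coefficient identification `cfi_coefficients_of_magicFormulaT`, with `G_f''(0) = 2 q(f)`
(`so_iteratedDeriv_two_cexp_mul_sq`) and `Φ_δ''(0) = E_{1/2}[3A₁² − 4A₂]` for `δ > 0`
(`so_iteratedDeriv_two_eq_ofReal_integral`), read through the closed embedding `ℝ → ℂ`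
(`Filter.tendsto_ofReal_iff`). -/
theorem twoPoint_of_magicFormulaT :
    Summit.CriticalPhenomena.CardyFormulaZ2.Theses.CardyMagicRigidity.MagicFormulaT →
    ∀ (f : ℂ → ℝ) (R C : ℝ), Measurable f → (∀ z, |f z| ≤ C) → (∀ z, R < ‖z‖ → f z = 0) → ∫ z, f z = 0 →
    Tendsto (fun δ : ℝ ↦ ∫ ω, (3 * (∑ᶠ u ∈ (siteLoopConfig δ ω).loops, u.nestingPhase f) ^ 2 -
      4 * (∑ᶠ u ∈ (siteLoopConfig δ ω).loops, u.nestingPhase f ^ 2)) ∂(triSitePercolation half))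
      (𝓝[>] (0 : ℝ)) (𝓝 (3 / (2 * π ^ 2) * ∫ x, ∫ y, Real.log ‖x - y‖ * f x * f y)) := by
  intro hM f R C hf hC hR h0
  -- the Gaussian side at order `2`: `G_f''(0) = 2 q(f)`, as the image of a real number
  have hval : ((3 / (2 * π ^ 2) * ∫ x, ∫ y, Real.log ‖x - y‖ * f x * f y : ℝ) : ℂ) =
      iteratedDeriv 2 (fun t : ℂ ↦ Complex.exp
        (((3 / (4 * π ^ 2) * ∫ x, ∫ y, Real.log ‖x - y‖ * f x * f y : ℝ) : ℂ) * t ^ 2)) 0 := by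
    rw [so_iteratedDeriv_two_cexp_mul_sq]
    push_cast
    ring
  -- pass to `ℂ` (closed embedding) and use the coefficient identification at order `2`; along
  -- `𝓝[>] 0` one has `δ > 0`, where `Φ_δ''(0)` is the real expectation of the power-sum statistic
  rw [← tendsto_ofReal_iff, hval]
  refine (cfi_coefficients_of_magicFormulaT hM hf hC hR h0 2).congr' ?_
  filter_upwards [self_mem_nhdsWithin] with δ hδ
  exact so_iteratedDeriv_two_eq_ofReal_integral hf hC hR h0 (mem_Ioi.1 hδ)

end Summit.CriticalPhenomena.CardyFormulaZ2.Cruxes.MagicFormulaT.LineSketch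

end
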